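import Literature.Computability.Complexity.ClockedUniversalAcceptanceProofs

/-!
# Route CompactnessLift · crux `CompactnessPrinciple` · line `universal-clock-padding` —
# `stub_squareClock`: square-clocked universal acceptance testing in polynomial time

The registered stub `stub_squareClock` of the lead skeleton
(`Cruxes/CompactnessPrinciple/Lines/universal_clock_padding_Sketch.lean`): a sibling `U₂` of the
tree's bounded acceptance language `ClockedUA.U` (`ClockedUniversalAcceptanceProofs.lean`,
Arora–Barak 2009, Thm. 1.9 with §1.4.1 "Universal TM with time bound") whose clock is the SQUARE
of the instance length: the decider runs `|inst|²` rounds of the guarded universal step `ClockedUA.F`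
from `⟨inst, ι inst⟩` and applies the same acceptance test `ClockedUA.checkF`. Consequently an
instance `⟨code M, ⟨w, u⟩⟩` is accepted as soon as `M` outputs `[true]` on `w` within `t` steps with
`haltAddr · t ≤ |inst|²` — no unary budget field is needed when `t = O(|w|)`, which is what the
line's instance map `W ↦ ⟨code M̂, ⟨W, ε⟩⟩` exploits.

Everything is the tree's pipeline verbatim with the clock polynomial `X²` for `X`
(`iterate_mem_FP_of_growth` is stated for an arbitrary clock polynomial, `pflat_complete` /
`pflat_sound` for an arbitrary round count): `orbitSq ∈ FP`, the verdict is one bit and in `FP`,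
`U₂ ∈ P` (`mem_P_of_mem_FP`), the honest orbit is the flat run (`ClockedUA.iterate_F_inst`),
completeness (`pflat_complete`) and soundness (`pflat_sound`, `exists_halt_of_iterate`,
`ClockedUA.encStacks_injective`). The three objects are written out as terms (no new definitions);
the machine lemmas are stated for any `orb` satisfying the orbit equation.

## References

* S. Arora, B. Barak, *Computational Complexity: A Modern Approach*, CUP 2009, Thm. 1.9 and
  §1.4.1 (universal TM with a time counter), Thm. 2.9 (`TMSAT`). [AroraBarakCC2009]
* S. Aaronson, D. van Melkebeek, *On circuit lower bounds from derandomization*, Theory of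
  Computing 7 (2011) 177–184, §3.3 (one exponent from a complete problem under linear-time
  reductions).
-/

-- the `Summit.QuantumAdvantage.QuantumAdvantage.…` namespace repeats summit = sub-problem (D-0017 layout)
set_option linter.dupNamespace false

noncomputable section

namespace Summit.QuantumAdvantage.QuantumAdvantage.Theorems

open Literature.Computability.Complexity
open _root_.Computability Polynomial Brick Turing
open UnivStep FlatProg TM2Std ClockedUA

/-! ### The square-clocked orbit is polynomial-time

The three objects of the decider — the orbit `orbitSq = (Z ↦ F^[|fst Z|²] Z) ∘ (inst ↦ ⟨inst, ι inst⟩)`,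
the verdict `checkF ∘ orbitSq` and the language `U₂ = {inst | verdict inst = [1]}` — are written out
as terms (no new definitions in a proof file); the lemmas about instances of a machine are stated
for an arbitrary `orb` satisfying the orbit equation `orb inst = F^[|inst|²] ⟨inst, ι inst⟩`. -/

/-- The orbit equation of the square-clocked orbit term: `F^[|inst|²] ⟨inst, ι inst⟩`.
[cite: AroraBarakCC2009, §1.4.1] -/
theorem orbitSq_apply (inst : List Bool) :
    ((fun Z : List Bool => F^[((X : Polynomial ℕ) ^ 2).eval (boolUnpair Z).1.length] Z) ∘
        fanoutFn (fun w : List Bool => w) ι) inst =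
      F^[inst.length ^ 2] (boolPair inst (ι inst)) := by
  simp

/-- **The square-clocked orbit is polynomial-time** (`iterate_mem_FP_of_growth` with clock `X²`:
`F ∈ FP` keeps the instance and grows the state by `≤ 6 (|inst| + 1)` per round).
[cite: AroraBarakCC2009, Thm. 1.9 and §1.4.1] -/
theorem orbitSq_mem_FP :
    ((fun Z : List Bool => F^[((X : Polynomial ℕ) ^ 2).eval (boolUnpair Z).1.length] Z) ∘
        fanoutFn (fun w : List Bool => w) ι) ∈ FP :=
  comp_mem_FP (iterate_mem_FP_of_growth F_mem_FP 6 fst_F length_F_le (X ^ 2))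
    (fanoutFn_mem_FP id_mem_FP ι_mem_FP)

/-- The verdict `checkF ∘ orb` is one bit, for any orbit map. [folklore] -/
theorem checkF_comp_eq_or (orb : List Bool → List Bool) (inst : List Bool) :
    (checkF ∘ orb) inst = [true] ∨ (checkF ∘ orb) inst = [false] := by
  have hone : OneBit checkF :=
    oneBit_andFn (oneBit_isNilFn.comp _)
      (OneBit.comp (fun w => (eqPairFn_eq_or w).elim (fun h => ⟨true, h⟩) fun h => ⟨false, h⟩) _)
  obtain ⟨b, hb⟩ := hone (orb inst)
  rw [Function.comp_apply, hb]
  cases b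
  · exact Or.inr rfl
  · exact Or.inl rfl

/-- `checkF ∘ orb ∈ FP` for any `orb ∈ FP`. [cite: AroraBarakCC2009, Thm. 1.9 and §1.4.1] -/
theorem checkF_comp_mem_FP {orb : List Bool → List Bool} (horb : orb ∈ FP) : checkF ∘ orb ∈ FP :=
  comp_mem_FP
    (andFn_mem_FP (comp_mem_FP isNilFn_mem_FP (comp_mem_FP insF_mem_FP sndF_mem_FP))
      (comp_mem_FP eqPairFn_mem_FP (fanoutFn_mem_FP (comp_mem_FP ssF_mem_FP sndF_mem_FP)
        (comp_mem_FP (comp_mem_FP (sndPow_mem_FP 3) (nthF_mem_FP 0)) fstF_mem_FP))))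
    horb

/-- **The accepted instances of an `FP` orbit map form a language in `P`.**
[cite: AroraBarakCC2009, Thm. 1.9 and §1.4.1] -/
theorem setOf_checkF_comp_mem_P {orb : List Bool → List Bool} (horb : orb ∈ FP) :
    ({inst : List Bool | (checkF ∘ orb) inst = [true]} : Language Bool) ∈ Classes.P :=
  mem_P_of_mem_FP (checkF_comp_mem_FP horb) _ fun w =>
    ⟨fun h => h, fun h => (checkF_comp_eq_or orb w).resolve_left h⟩

/-! ### The honest orbit of an instance of a machine -/

section Machine

variable (M : TM2ComputableAux Bool Bool) {orb : List Bool → List Bool}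
  (horb : ∀ inst : List Bool, orb inst = F^[inst.length ^ 2] (boolPair inst (ι inst)))
include horb

/-- The square-clocked orbit of an instance of `M` is the flat run of `|inst|²` steps.
[cite: AroraBarakCC2009, Thm. 1.9 and §1.4.1] -/
theorem orbitSq_inst (w u : List Bool) :
    orb (inst M w u) = boolPair (inst M w u)
      (enc (PM M) ((step (PM M))^[(inst M w u).length ^ 2] (pinitCfg M (π M) w))) := by
  rw [horb, ι_inst, iterate_F_inst]

/-- **The square-clocked verdict on an instance of `M`**: the flat configuration after `|inst|²`
steps is halted and its stacks field is the target. [cite: AroraBarakCC2009, §1.4.1] -/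
theorem verdictSq_inst (w u : List Bool) :
    (checkF ∘ orb) (inst M w u) =
      [decide (insF (enc (PM M) ((step (PM M))^[(inst M w u).length ^ 2] (pinitCfg M (π M) w))) = []) &&
        decide (ssF (enc (PM M) ((step (PM M))^[(inst M w u).length ^ 2] (pinitCfg M (π M) w))) =
          tgtS M)] := by
  have ht : tgtI (inst M w u) = tgtS M := by rw [inst, ClockedUA.code, tgtI_apply]
  rw [Function.comp_apply, orbitSq_inst M horb, checkF_boolPair, ht]

/-- **Completeness**: if `M` outputs `[true]` on `w` within `t` steps and `t · haltAddr ≤ |inst|²`,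
the instance `⟨code M, ⟨w, u⟩⟩` is accepted (for EVERY padding `u`).
[cite: AroraBarakCC2009, Thm. 1.9 and §1.4.1] -/
theorem completeSq {w u : List Bool} {t : ℕ} (h : M.OutputsWithin w [true] t)
    (hR : t * haltAddr (cM M) ≤ (inst M w u).length ^ 2) : (checkF ∘ orb) (inst M w u) = [true] := by
  have hrun : (step (PM M))^[(inst M w u).length ^ 2] (pinitCfg M (π M) w) =
      phaltCfg M (π M) [true] := pflat_complete M (π M) h hR
  rw [verdictSq_inst M horb, hrun, (insF_enc_eq_nil_iff _ _).2 (by rw [length_compile, phaltCfg_fst]),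
    ssF_enc]
  simp [tgtS]

/-- **Soundness**: if the instance `⟨code M, ⟨w, u⟩⟩` is accepted then `M` outputs `[true]` on `w`
(within `|inst|²` steps). [cite: AroraBarakCC2009, Thm. 1.9 and §1.4.1] -/
theorem soundSq {w u : List Bool} (h : (checkF ∘ orb) (inst M w u) = [true]) :
    ∃ t, M.OutputsWithin w [true] t := by
  have hv := h
  rw [verdictSq_inst M horb] at hv
  simp only [List.cons.injEq, Bool.and_eq_true, decide_eq_true_eq, and_true] at hv
  obtain ⟨hhalt, hstk⟩ := hv
  refine ⟨(inst M w u).length ^ 2, pflat_sound M (π M) (Prod.ext ?_ ?_)⟩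
  · -- the flat configuration reached is halted, so its program counter is the halt address
    have hpc : haltAddr (cM M) ≤ ((step (compile (cM M)))^[(inst M w u).length ^ 2] (trCfg (cM M)
        (initList (cM M).tm ((inCode M w).map (π M))))).1 := by
      rw [← length_compile]
      exact (insF_enc_eq_nil_iff _ _).1 hhalt
    obtain ⟨n, -, d, -, hd, hfin⟩ := exists_halt_of_iterate (cM M) _ _ hpc
    rw [phaltCfg_fst]
    show ((step (compile (cM M)))^[(inst M w u).length ^ 2] (trCfg (cM M)
      (initList (cM M).tm ((inCode M w).map (π M))))).1 = _
    rw [hfin]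
    exact trCfg_fst_of_none _ ((step_eq_none_iff _ d).1 hd)
  · -- ... and its stacks are the target stacks
    rw [ssF_enc, tgtS] at hstk
    exact encStacks_injective hstk

end Machine

/-! ### The registered stub -/

/-- **Stub `stub_squareClock` — square-clocked universal acceptance** (sibling of `ClockedUA.U`,
Arora–Barak 2009 Thm. 1.9 / §1.4.1 with the clock `|inst|²` instead of `|inst|`): there is ONE
language `U₂ ∈ P` such that every machine `M` has a code `e` (`ClockedUA.code M`) and an overhead
constant `h` (`haltAddr`, one step of `M` costs at most `h` flat steps) with (completeness) if `M`
outputs `[true]` on `w` within `t` steps and `h · t ≤ |⟨e, ⟨w, u⟩⟩|²` then `⟨e, ⟨w, u⟩⟩ ∈ U₂`, and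
(soundness) if `⟨e, ⟨w, u⟩⟩ ∈ U₂` then `M` outputs `[true]` on `w`. Here
`U₂ = {inst | (checkF ∘ orbitSq) inst = [1]}` with the square-clocked orbit term of `orbitSq_apply`.
[cite: AroraBarakCC2009, Thm. 1.9 and §1.4.1] -/
theorem stub_squareClock :
    ∃ U₂ : Language Bool, U₂ ∈ Classes.P ∧
      ∀ M : Turing.TM2ComputableAux Bool Bool, ∃ (e : List Bool) (h : ℕ),
        (∀ (w u : List Bool) (t : ℕ), M.OutputsWithin w [true] t →
            h * t ≤ (boolPair e (boolPair w u)).length ^ 2 → boolPair e (boolPair w u) ∈ U₂) ∧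
        (∀ w u : List Bool, boolPair e (boolPair w u) ∈ U₂ → ∃ t : ℕ, M.OutputsWithin w [true] t) :=
  ⟨{inst : List Bool | (checkF ∘ ((fun Z : List Bool =>
        F^[((X : Polynomial ℕ) ^ 2).eval (boolUnpair Z).1.length] Z) ∘
      fanoutFn (fun w : List Bool => w) ι)) inst = [true]},
    setOf_checkF_comp_mem_P orbitSq_mem_FP, fun M => ⟨ClockedUA.code M, haltAddr (cM M),
      fun _ _ _ h hR => completeSq M orbitSq_apply h (by rw [Nat.mul_comm]; exact hR),
      fun _ _ h => soundSq M orbitSq_apply h⟩⟩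

end Summit.QuantumAdvantage.QuantumAdvantage.Theorems
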